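import Literature.AnabelianGeometry.EtaleTheta.Discharge.Sec2ProfiniteCompletion
import Literature.AnabelianGeometry.SemiGraphs.FreeGroupsAndActions
import Mathlib.GroupTheory.FreeGroup.NielsenSchreier

/-!
# [EtTh] Lemma 2.17 (i) "Discrete Normalizers" — discharge modulo the three printed inputs

Mochizuki, *The Étale Theta Function and its Frobenioid-theoretic Manifestations* [EtTh],
Publ. RIMS 45 (2009), §2, Lemma 2.17 (i), PRIMS text pp.58–59 (printed pp.284–285; locators
`p.N` = PDF pages of the PRIMS text; bib key `MochizukiEtTh2009`):

> "Let `F` be a group that contains a normal subgroup of finite index `G ⊆ F` such that `G` is a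
> free discrete group of finite rank; `H ⊆ F` a subgroup such that the group `H ⋂ G` is nonabelian.
> … Then `N_{F̂}(H) = N_F(H)`."

PROOF-ONLY companion (no definitions, no named facts introduced) of the typed statement
`ThetaCovers.TemperedCoverData.Lem217_i` (abc-iut-L2-t2, `ThetaCoversTempered.lean`): the theorem
`lem217_i_of_facts` below has LITERALLY that statement as its conclusion, and as hypotheses the
three printed inputs of the proof on pp.58–59, each BY NAME / in the cell's shapes:

* (a) `SemiGraphs.corollary_1_6_ii` — [SemiAnbd] Cor. 1.6 (ii) (Tamagawa / M. Hall): "`x_{i₁}, x_{i₂}`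
  appear in some collection of free generators of `J` [cf. [Mzk14], Corollary 1.6, (ii)]" (tree
  FACT, `SemiGraphs/FreeGroupsAndActions.lean`);
* (b) P. Stebe's conjugacy separability of free groups: "by a classical result of P. Stebe [cf.
  [LynSch], Proposition 4.9], it follows that `J` is conjugacy-separated" (cell shape
  `FreeGroup.exists_normal_finiteIndex_not_isConj`, abc-iut-L5-t14, packaged over
  `FiniteIndexNormalSubgroup`);
* (c) "the centralizer of `x_{i_j}` in the profinite completion `Ĵ` of `J` is topologically
  generated by `x_{i_j}` [cf., e.g., [Mzk15], Proposition 1.2, (ii)]" ([CombGC] Prop. 1.2 (ii);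
  the cell's (CC)+(CZ) of abc-iut-L5-d2).

Route (ours, finite quotients only — no `Ẑ`-exponents): Stebe makes the conjugating element
discrete; (c) puts `c_j := η(g_j)⁻¹ γ` in the closure of `⟨η x_{i_j}⟩`; the printed step "by
considering the image of `c₁, c₂` in the abelianization of `Ĵ`" is replaced by reading
`c₁ c₂⁻¹ = η(d)` through the retraction `J → J` killing every generator but `x_{i₁}` in the finite
quotients `J ⧸ (N ∩ π₀⁻¹N)` (`mem_range_eta_of_conj_basis`); the passage `F̂ ⊇ Ĵ`, `F ⋂ Ĵ = J` is the
transfer lemma of `Sec2ProfiniteCompletion.lean`.  Normality of `G` is not used.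

Honest framing: classical combinatorial / profinite group theory; nothing here concerns
[IUTchIII] Cor. 3.12; typed ≠ discharged — Lemma 2.17 (i) is discharged here MODULO (a)(b)(c).
-/

namespace Literature.AnabelianGeometry.EtaleTheta.DiscreteNormalizers

open CategoryTheory ProfiniteGrp ProfiniteGrp.ProfiniteCompletion Topology

universe u


/-! ### The free-group core: Stebe + centralizers of free generators -/

/-- Conjugacy separability of free groups (the named input, in the cell's shape
`FreeGroup.exists_normal_finiteIndex_not_isConj`) transported to a group with a free basis and
applied in the completion: elements of `T` conjugate in `T̂` are conjugate in `T`.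
[cite: MochizukiEtTh2009, Lem 2.17 proof p.59 (PRIMS p.285): "by a classical result of P. Stebe
[cf. [LynSch], Proposition 4.9] ... J is conjugacy-separated"] -/
theorem isConj_of_conj_eta {T : Type u} [Group T] (ηT : T →* completion (GrpCat.of T))
    (hηT : ∀ (g : T) (N : FiniteIndexNormalSubgroup T),
      (ηT g).val N = (QuotientGroup.mk g : T ⧸ N.toSubgroup))
    {κ : Type u} (β : FreeGroupBasis κ T)
    (hStebe : ∀ u v : FreeGroup κ, ¬ IsConj u v →
      ∃ K : FiniteIndexNormalSubgroup (FreeGroup κ),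
        ¬ IsConj (QuotientGroup.mk u : FreeGroup κ ⧸ K.toSubgroup) (QuotientGroup.mk v))
    {z w : T} (γ : completion (GrpCat.of T)) (h : γ * ηT z * γ⁻¹ = ηT w) : IsConj z w := by
  by_contra hzw
  have huv : ¬ IsConj (β.repr z) (β.repr w) := by
    intro h'
    apply hzw
    simpa using β.repr.symm.toMonoidHom.map_isConj h'
  obtain ⟨K, hK⟩ := hStebe _ _ huv
  let K' : Subgroup T := K.toSubgroup.comap β.repr.toMonoidHom
  haveI : K'.Normal := Subgroup.Normal.comap inferInstance _
  haveI : K'.FiniteIndex := by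
    have hsurj : Function.Surjective (β.repr.toMonoidHom : T →* FreeGroup κ) :=
      fun x => ⟨β.repr.symm x, by simp⟩
    rw [Subgroup.finiteIndex_iff, K.toSubgroup.index_comap_of_surjective hsurj]
    exact Subgroup.FiniteIndex.index_ne_zero
  have hc : IsConj (ηT z) (ηT w) := isConj_iff.mpr ⟨γ, h⟩
  have h1 := isConj_mk_of_isConj_eta ηT hηT hc (FiniteIndexNormalSubgroup.ofSubgroup K')
  let ψ : T ⧸ K' →* FreeGroup κ ⧸ K.toSubgroup :=
    QuotientGroup.map K' K.toSubgroup β.repr.toMonoidHom fun _ hx => hx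
  have h2 := ψ.map_isConj h1
  apply hK
  simpa only [ψ, FiniteIndexNormalSubgroup.toSubgroup_ofSubgroup, QuotientGroup.map_mk,
    MulEquiv.coe_toMonoidHom] using h2

/-- **Free-group core of [EtTh] Lemma 2.17 (i).**  Let `T` be free with basis `β`, `i₁ ≠ i₂`, and
let `γ ∈ T̂` conjugate both `η(β i₁)` and `η(β i₂)` into `η(T)`.  Then `γ ∈ η(T)`.  Inputs BY NAME:
Stebe's conjugacy separability (`hStebe`) and the pro-cyclicity of centralizers of free generators in
`T̂` (`hCent`, [CombGC] Prop. 1.2 (ii) as invoked on [EtTh] p.285).  The integrality of the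
`Ẑ`-exponents ("by considering the image of `c₁, c₂` in the abelianization") is done through the
retraction `T → T` killing all generators but `β i₁` and finite quotients.
[cite: MochizukiEtTh2009, Lem 2.17 (i) proof pp.58–59 (PRIMS pp.284–285)] -/
theorem mem_range_eta_of_conj_basis {T : Type u} [Group T] (ηT : T →* completion (GrpCat.of T))
    (hηT : ∀ (g : T) (N : FiniteIndexNormalSubgroup T),
      (ηT g).val N = (QuotientGroup.mk g : T ⧸ N.toSubgroup))
    {κ : Type u} (β : FreeGroupBasis κ T)
    (hStebe : ∀ u v : FreeGroup κ, ¬ IsConj u v →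
      ∃ K : FiniteIndexNormalSubgroup (FreeGroup κ),
        ¬ IsConj (QuotientGroup.mk u : FreeGroup κ ⧸ K.toSubgroup) (QuotientGroup.mk v))
    (hCent : ∀ i : κ, Subgroup.centralizer {ηT (β i)} ≤
      (Subgroup.zpowers (ηT (β i))).topologicalClosure)
    {i₁ i₂ : κ} (hne : i₁ ≠ i₂) (γ : completion (GrpCat.of T))
    (h₁ : γ * ηT (β i₁) * γ⁻¹ ∈ (ηT).range) (h₂ : γ * ηT (β i₂) * γ⁻¹ ∈ (ηT).range) :
    γ ∈ (ηT).range := by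
  classical
  obtain ⟨w₁, hw₁⟩ := h₁
  obtain ⟨w₂, hw₂⟩ := h₂
  -- Stebe: the conjugating element may be taken in `T`
  obtain ⟨g₁, hg₁⟩ := isConj_iff.mp (isConj_of_conj_eta ηT hηT β hStebe γ hw₁.symm)
  obtain ⟨g₂, hg₂⟩ := isConj_iff.mp (isConj_of_conj_eta ηT hηT β hStebe γ hw₂.symm)
  -- `c_j := η(g_j)⁻¹ γ` centralises `η(β i_j)`
  have hcent : ∀ (i : κ) (g w : T), ηT w = γ * ηT (β i) * γ⁻¹ → g * β i * g⁻¹ = w →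
      (ηT g)⁻¹ * γ ∈ Subgroup.centralizer {ηT (β i)} := by
    intro i g w hw hg
    rw [Subgroup.mem_centralizer_iff]
    intro y hy
    rw [Set.mem_singleton_iff] at hy
    subst hy
    have key : γ * ηT (β i) * γ⁻¹ = ηT g * ηT (β i) * (ηT g)⁻¹ := by
      rw [← hw, ← hg, map_mul, map_mul, map_inv]
    calc ηT (β i) * ((ηT g)⁻¹ * γ)
        = (ηT g)⁻¹ * (ηT g * ηT (β i) * (ηT g)⁻¹) * γ := by group
      _ = (ηT g)⁻¹ * (γ * ηT (β i) * γ⁻¹) * γ := by rw [key]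
      _ = (ηT g)⁻¹ * γ * ηT (β i) := by group
  have hc₁ := hCent i₁ (hcent i₁ g₁ w₁ hw₁ hg₁)
  have hc₂ := hCent i₂ (hcent i₂ g₂ w₂ hw₂ hg₂)
  -- the retraction `π₀ : T → T`, `β i₁ ↦ β i₁`, `β i ↦ 1` (`i ≠ i₁`)
  let π₀ : T →* T :=
    (FreeGroup.lift fun i => if i = i₁ then β i₁ else (1 : T)).comp β.repr.toMonoidHom
  have hπ₁ : π₀ (β i₁) = β i₁ := by simp [π₀]
  have hπ₂ : π₀ (β i₂) = 1 := by simp [π₀, hne.symm]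
  -- `d := g₁⁻¹ g₂`, `c₁ c₂⁻¹ = η d`
  set d : T := g₁⁻¹ * g₂ with hd
  have hcd : ((ηT g₁)⁻¹ * γ) * ((ηT g₂)⁻¹ * γ)⁻¹ = ηT d := by
    rw [hd, map_mul, map_inv]; group
  -- components of `c₁` are the classes of `π₀ d`
  have hval : ∀ N : FiniteIndexNormalSubgroup T,
      ((ηT g₁)⁻¹ * γ).val N = (QuotientGroup.mk (π₀ d) : T ⧸ N.toSubgroup) := by
    intro N
    -- an auxiliary deeper level `N₁ = Ker(T → T/N × T/N, t ↦ (t, π₀ t))`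
    let ψ : T →* (T ⧸ N.toSubgroup) × (T ⧸ N.toSubgroup) :=
      (QuotientGroup.mk' N.toSubgroup).prod ((QuotientGroup.mk' N.toSubgroup).comp π₀)
    haveI : ψ.ker.FiniteIndex := inferInstance
    let N₁ : FiniteIndexNormalSubgroup T := FiniteIndexNormalSubgroup.ofSubgroup ψ.ker
    have hN₁ : N₁ ≤ N := by
      intro x hx
      have hx' : ψ x = 1 := hx
      have : (QuotientGroup.mk x : T ⧸ N.toSubgroup) = 1 := (Prod.ext_iff.mp hx').1
      exact (QuotientGroup.eq_one_iff x).mp this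
    obtain ⟨k, hk⟩ := exists_val_eq_mk_zpow_of_mem_closure_zpowers ηT hηT (β i₁) hc₁ N₁
    obtain ⟨l, hl⟩ := exists_val_eq_mk_zpow_of_mem_closure_zpowers ηT hηT (β i₂) hc₂ N₁
    -- read `c₁ c₂⁻¹ = η d` at level `N₁`
    have e1 : (QuotientGroup.mk (β i₁ ^ k * (β i₂ ^ l)⁻¹) : T ⧸ N₁.toSubgroup) = QuotientGroup.mk d := by
      obtain ⟨π, hπ⟩ := exists_proj N₁
      have := congrArg π hcd
      rw [map_mul, map_inv, hπ, hπ, hπ, hk, hl, hηT] at this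
      rwa [← QuotientGroup.mk_inv, ← QuotientGroup.mk_mul] at this
    have e2 : ψ (β i₁ ^ k * (β i₂ ^ l)⁻¹) = ψ d := by
      have h' : (β i₁ ^ k * (β i₂ ^ l)⁻¹)⁻¹ * d ∈ ψ.ker := QuotientGroup.eq.mp e1
      rw [MonoidHom.mem_ker, map_mul, map_inv, inv_mul_eq_one] at h'
      exact h'
    have e3 : (QuotientGroup.mk (β i₁ ^ k) : T ⧸ N.toSubgroup) = QuotientGroup.mk (π₀ d) := by
      have := congrArg Prod.snd e2
      simpa [ψ, map_mul, map_inv, map_zpow, hπ₁, hπ₂] using this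
    rw [← e3]
    exact val_eq_mk_of_le _ hN₁ hk
  -- conclude
  have hc₁eq : (ηT g₁)⁻¹ * γ = ηT (π₀ d) := (eq_eta_iff ηT hηT _ _).mpr hval
  refine ⟨g₁ * π₀ d, ?_⟩
  rw [map_mul, ← hc₁eq]
  group

/-! ### [EtTh] Lemma 2.17 (i) -/

/-- Free groups on a subsingleton are commutative (used to see that the rank-two hypothesis
"`H ∩ G` nonabelian" forces two distinct free generators). [cite: MochizukiEtTh2009, Lem 2.17(i) p.58] -/
theorem freeGroup_mul_comm_of_subsingleton {κ : Type*} [Subsingleton κ] (g h : FreeGroup κ) :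
    g * h = h * g := by
  have hof : ∀ (j : κ) (g : FreeGroup κ), g * FreeGroup.of j = FreeGroup.of j * g := by
    intro j g
    induction g with
    | C1 => simp
    | of j' => rw [Subsingleton.elim j' j]
    | inv_of j' _ => rw [Subsingleton.elim j' j, inv_mul_cancel, mul_inv_cancel]
    | mul a b ha hb => rw [mul_assoc, hb, ← mul_assoc, ha, mul_assoc]
  induction h with
  | C1 => simp
  | of j => exact hof j g
  | inv_of j _ =>
    have hj := hof j g
    calc g * (FreeGroup.of j)⁻¹
        = (FreeGroup.of j)⁻¹ * (FreeGroup.of j * g) * (FreeGroup.of j)⁻¹ := by group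
      _ = (FreeGroup.of j)⁻¹ * (g * FreeGroup.of j) * (FreeGroup.of j)⁻¹ := by rw [hj]
      _ = (FreeGroup.of j)⁻¹ * g := by group
  | mul a b ha hb => rw [← mul_assoc, ha, mul_assoc, hb, ← mul_assoc]

/-- **[EtTh] Lemma 2.17 (i) (Discrete Normalizers)**, in the typed shape of
`ThetaCovers.TemperedCoverData.Lem217_i` (abc-iut-L2-t2): "Let `F` be a group that contains a
normal subgroup of finite index `G ⊆ F` such that `G` is a free discrete group of finite rank;
`H ⊆ F` a subgroup such that the group `H ⋂ G` is nonabelian. Write `F̂, Ĝ` for the profinite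
completions of `F, G`. Then `N_{F̂}(H) = N_F(H)`."  Proved MODULO the three printed inputs of the
proof (pp.58–59), taken BY NAME: `hHall` = [SemiAnbd] Cor. 1.6 (ii) (tree FACT
`SemiGraphs.corollary_1_6_ii`), `hStebe` = P. Stebe's conjugacy separability of free groups
([LynSch] Prop. I.4.9; cell shape `FreeGroup.exists_normal_finiteIndex_not_isConj`), `hCent` = the
pro-cyclicity of centralizers of free generators in the profinite completion ([CombGC] Prop. 1.2
(ii) as cited on p.285).  Normality of `G` is not used.  Stated for any `η : F →* F̂` with the
components of the canonical map (`hη`; Mathlib's `eta` satisfies it by `rfl`, see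
`lem217_i_of_facts`). [cite: MochizukiEtTh2009, Lem 2.17 (i) pp.58–59 (PRIMS pp.284–285)] -/
theorem normalizer_map_eta_eq_of_facts
    (hHall : SemiGraphs.corollary_1_6_ii.{u})
    (hStebe : ∀ (κ : Type u) (u v : FreeGroup κ), ¬ IsConj u v →
      ∃ K : FiniteIndexNormalSubgroup (FreeGroup κ),
        ¬ IsConj (QuotientGroup.mk u : FreeGroup κ ⧸ K.toSubgroup) (QuotientGroup.mk v))
    (hCent : ∀ (J : Type u) [Group J] (κ : Type u) (β : FreeGroupBasis κ J) (i : κ),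
      let η : J →* ProfiniteGrp.ProfiniteCompletion.completion (GrpCat.of J) :=
        (ProfiniteGrp.ProfiniteCompletion.eta (GrpCat.of J)).hom
      Subgroup.centralizer {η (β i)} ≤ (Subgroup.zpowers (η (β i))).topologicalClosure)
    (F : Type u) [Group F] (η : F →* completion (GrpCat.of F))
    (hη : ∀ (g : F) (N : FiniteIndexNormalSubgroup F),
      (η g).val N = (QuotientGroup.mk g : F ⧸ N.toSubgroup))
    (G H : Subgroup F) [IsFreeGroup G] (_hGn : G.Normal)
    (hGi : G.FiniteIndex) (hfin : Finite (IsFreeGroup.Generators G))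
    (hnc : ∃ a ∈ H ⊓ G, ∃ b ∈ H ⊓ G, a * b ≠ b * a) :
    Subgroup.normalizer ((H.map η : Subgroup (completion (GrpCat.of F))) :
        Set (completion (GrpCat.of F))) =
      (Subgroup.normalizer (H : Set F)).map η := by
  classical
  haveI := hGi
  haveI := hfin
  have hinj := eta_injective_of_virtuallyFree η hη G
  apply le_antisymm
  swap
  · -- `η(N_F(H)) ⊆ N_{F̂}(η H)` (formal)
    rintro _ ⟨f, hf, rfl⟩
    rw [SetLike.mem_coe, Subgroup.mem_normalizer_iff] at hf
    rw [Subgroup.mem_normalizer_iff]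
    intro m
    constructor
    · rintro ⟨h, hh, rfl⟩
      exact ⟨f * h * f⁻¹, (hf h).mp hh, by rw [map_mul, map_mul, map_inv]⟩
    · rintro ⟨h', hh', he⟩
      refine ⟨f⁻¹ * h' * f, (hf (f⁻¹ * h' * f)).mpr (by simpa [mul_assoc] using hh'), ?_⟩
      rw [map_mul, map_mul, map_inv, he]
      group
  · -- `N_{F̂}(η H) ⊆ η(N_F(H))` (the content)
    intro a ha
    rw [Subgroup.mem_normalizer_iff] at ha
    -- (1) two non-commuting elements of `H ∩ G`; the free group `F₀` they generate
    obtain ⟨x, hx, y, hy, hxy⟩ := hnc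
    let bG : FreeGroupBasis (IsFreeGroup.Generators G) G := IsFreeGroup.basis G
    let x' : G := ⟨x, (Subgroup.mem_inf.mp hx).2⟩
    let y' : G := ⟨y, (Subgroup.mem_inf.mp hy).2⟩
    let F₀ : Subgroup G := Subgroup.closure {x', y'}
    have hF₀fg : F₀.FG := ⟨{x', y'}, by simp [F₀]⟩
    have hF₀H : F₀ ≤ H.comap G.subtype := by
      rw [Subgroup.closure_le]
      intro t ht
      simp only [Set.mem_insert_iff, Set.mem_singleton_iff] at ht
      rcases ht with rfl | rfl
      · exact (Subgroup.mem_inf.mp hx).1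
      · exact (Subgroup.mem_inf.mp hy).1
    -- (2) [SemiAnbd] Cor 1.6 (ii): a finite-index `J' ≤ G` containing `F₀` with compatible bases
    obtain ⟨J', hJ'fi, hF₀J', κ₁, κ₂, _, _, bH, bF, hbb⟩ :=
      hHall G (IsFreeGroup.Generators G) bG F₀ hF₀fg
    -- two distinct basis indices of `F₀` (else `F₀`, hence `x, y`, would commute)
    obtain ⟨i₁, i₂, hne⟩ : ∃ i₁ i₂ : κ₁, i₁ ≠ i₂ := by
      by_contra hcon
      push Not at hcon
      haveI : Subsingleton κ₁ := ⟨hcon⟩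
      apply hxy
      have hx'' : x' ∈ F₀ := Subgroup.subset_closure (by simp)
      have hy'' : y' ∈ F₀ := Subgroup.subset_closure (by simp)
      have key : bF.repr ⟨x', hx''⟩ * bF.repr ⟨y', hy''⟩ = bF.repr ⟨y', hy''⟩ * bF.repr ⟨x', hx''⟩ :=
        freeGroup_mul_comm_of_subsingleton _ _
      rw [← map_mul, ← map_mul, bF.repr.apply_eq_iff_eq] at key
      have := congrArg (fun t : F₀ => ((t : G) : F)) key
      simpa using this
    -- (3) `T := J'` as an abstract group, `φ : T ↪ F` with finite-index image
    let φ : J' →* F := G.subtype.comp J'.subtype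
    have hφ : Function.Injective φ := fun s t h => Subtype.ext (Subtype.ext h)
    have hφrange : φ.range = J'.map G.subtype := by
      rw [MonoidHom.range_comp, Subgroup.range_subtype]
    haveI : φ.range.FiniteIndex := by
      rw [hφrange, Subgroup.finiteIndex_iff, Subgroup.index_map_subtype]
      exact mul_ne_zero hJ'fi.index_ne_zero hGi.index_ne_zero
    -- the generators `z_i := bH (inl i)` of `J'` map into `H`
    have hzH : ∀ i : κ₁, φ (bH (Sum.inl i)) ∈ H := by
      intro i
      have h1 : ((bF i : F₀) : G) ∈ H.comap G.subtype := hF₀H (bF i).2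
      have h2 : ((bF i : F₀) : G) = (bH (Sum.inl i) : G) := hbb i
      rw [h2] at h1
      exact h1
    -- the canonical map of `T := J'` into its own completion
    let ηT : J' →* completion (GrpCat.of J') :=
      (ProfiniteGrp.ProfiniteCompletion.eta (GrpCat.of J')).hom
    have hηT : ∀ (g : J') (N : FiniteIndexNormalSubgroup J'),
        (ηT g).val N = (QuotientGroup.mk g : J' ⧸ N.toSubgroup) := fun _ _ => rfl
    -- (4) `a = η(b) · a₀` with all components of `a₀` in `φ(T)`
    obtain ⟨b, hb⟩ := exists_eta_mul_of_finiteIndex η hη φ.range a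
    set a₀ : completion (GrpCat.of F) := (η b)⁻¹ * a with ha₀
    have h₀ : ∀ N : FiniteIndexNormalSubgroup F, ∃ t : J',
        a₀.val N = (QuotientGroup.mk (φ t) : F ⧸ N.toSubgroup) := by
      intro N
      obtain ⟨j, ⟨t, rfl⟩, hj⟩ := hb N
      exact ⟨t, hj⟩
    obtain ⟨γ, hγrel, hγback⟩ := exists_transfer η hη ηT hηT φ hφ a₀ h₀
    -- (5) `a₀` conjugates each `η(φ z_i)` to an element of `η(φ T)`
    have hrel : ∀ i : κ₁, ∃ w : J', a₀ * η (φ (bH (Sum.inl i))) * a₀⁻¹ = η (φ w) := by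
      intro i
      have h1 : a * η (φ (bH (Sum.inl i))) * a⁻¹ ∈ H.map η :=
        (ha _).mp ⟨φ (bH (Sum.inl i)), hzH i, rfl⟩
      obtain ⟨h', hh', hh'eq⟩ := h1
      have h2 : a₀ * η (φ (bH (Sum.inl i))) * a₀⁻¹ = η (b⁻¹ * h' * b) := by
        rw [ha₀, map_mul, map_mul, map_inv, hh'eq]
        group
      have h3 : b⁻¹ * h' * b ∈ φ.range := by
        apply mem_of_forall_val_eta η hη φ.range
        intro N
        obtain ⟨t, ht⟩ := h₀ N
        refine ⟨φ (t * bH (Sum.inl i) * t⁻¹), ⟨_, rfl⟩, ?_⟩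
        obtain ⟨π, hπ⟩ := exists_proj N
        rw [← h2, ← hπ, map_mul, map_mul, map_inv, hπ, hπ, ht, hη]
        simp only [map_mul, map_inv, QuotientGroup.mk_mul, QuotientGroup.mk_inv]
      obtain ⟨w, hw⟩ := h3
      exact ⟨w, by rw [h2, hw]⟩
    have hrelT : ∀ i : κ₁, γ * ηT (bH (Sum.inl i)) * γ⁻¹ ∈ ηT.range := by
      intro i
      obtain ⟨w, hw⟩ := hrel i
      exact ⟨w, (hγrel _ _ hw).symm⟩
    -- (6) the free-group core in `T̂`
    have hγ : γ ∈ ηT.range :=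
      mem_range_eta_of_conj_basis ηT hηT bH (hStebe _) (fun i => hCent J' _ bH i)
        (fun h => hne (Sum.inl_injective h)) γ (hrelT i₁) (hrelT i₂)
    obtain ⟨t₀, ht₀⟩ := hγ
    have ha₀eq : a₀ = η (φ t₀) := hγback t₀ ht₀.symm
    have haeq : a = η (b * φ t₀) := by
      rw [map_mul, ← ha₀eq, ha₀]
      group
    -- (7) `a = η(b · φ t₀)` and `b · φ t₀` normalises `H` (by injectivity of `η`)
    refine ⟨b * φ t₀, ?_, haeq.symm⟩
    rw [SetLike.mem_coe, Subgroup.mem_normalizer_iff]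
    intro n
    constructor
    · intro hn
      obtain ⟨h', hh', he⟩ := (ha (η n)).mp ⟨n, hn, rfl⟩
      rw [haeq, ← map_mul, ← map_inv, ← map_mul] at he
      rw [← hinj he]
      exact hh'
    · intro hn
      obtain ⟨h', hh', he⟩ :=
        (ha (η n)).mpr ⟨_, hn, by rw [haeq, map_mul, map_mul, map_inv]⟩
      rw [← hinj he]
      exact hh'

/-- **[EtTh] Lemma 2.17 (i)**, restated LITERALLY in the typed shape of
`Literature.AnabelianGeometry.EtaleTheta.ThetaCovers.TemperedCoverData.Lem217_i` (abc-iut-L2-t2,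
`ThetaCoversTempered.lean`), with the inputs (a) [SemiAnbd] Cor. 1.6 (ii), (b) Stebe, (c) the
centralizer fact written over Mathlib's `ProfiniteGrp.ProfiniteCompletion.eta`; the bridge
`Lem217_i_of_facts : … → TemperedCoverData.Lem217_i` is then `fun ha hb hc => lem217_i_of_facts ha hb hc`.
[cite: MochizukiEtTh2009, Lem 2.17 (i) pp.58–59 (PRIMS pp.284–285)] -/
theorem lem217_i_of_facts
    (hHall : SemiGraphs.corollary_1_6_ii.{u})
    (hStebe : ∀ (κ : Type u) (u v : FreeGroup κ), ¬ IsConj u v →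
      ∃ K : FiniteIndexNormalSubgroup (FreeGroup κ),
        ¬ IsConj (QuotientGroup.mk u : FreeGroup κ ⧸ K.toSubgroup) (QuotientGroup.mk v))
    (hCent : ∀ (J : Type u) [Group J] (κ : Type u) (β : FreeGroupBasis κ J) (i : κ),
      let η : J →* ProfiniteGrp.ProfiniteCompletion.completion (GrpCat.of J) :=
        (ProfiniteGrp.ProfiniteCompletion.eta (GrpCat.of J)).hom
      Subgroup.centralizer {η (β i)} ≤ (Subgroup.zpowers (η (β i))).topologicalClosure) :
    ∀ (F : Type u) [Group F] (G H : Subgroup F) [IsFreeGroup G], G.Normal → G.FiniteIndex →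
      Finite (IsFreeGroup.Generators G) → (∃ a ∈ H ⊓ G, ∃ b ∈ H ⊓ G, a * b ≠ b * a) →
      let η : F →* ProfiniteGrp.ProfiniteCompletion.completion (GrpCat.of F) :=
        (ProfiniteGrp.ProfiniteCompletion.eta (GrpCat.of F)).hom
      Subgroup.normalizer ((H.map η : Subgroup _) : Set _) =
        (Subgroup.normalizer (H : Set F)).map η :=
  fun F _ G H _ hGn hGi hfin hnc =>
    normalizer_map_eta_eq_of_facts hHall hStebe hCent F _ (fun _ _ => rfl) G H hGn hGi hfin hnc

end Literature.AnabelianGeometry.EtaleTheta.DiscreteNormalizers
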